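import Literature.Analysis.SpecialFunctions.HypergeometricEulerIntegralSeries
import HarnessLib

/-!
# Pfaff's transformation for Euler's hypergeometric integral on the half-plane `Re z < 1`

Continuation of `HypergeometricEulerIntegral.lean` / `HypergeometricEulerIntegralSeries.lean`
(`eulerHypergeometric a b c z = Γ(c)/(Γ(b)Γ(c−b)) ∫₀¹ t^{b−1}(1−t)^{c−b−1}(1−zt)^{−a} dt` on
`H = {Re z < 1}`). Here: **Pfaff's transformation** (DLMF 15.8.1, first form)

  `E(a,b;c;z) = (1 − z)^{−a} E(a, c−b; c; z/(z−1))`,      `Re z < 1`,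

for Euler's integral — it holds for ALL complex parameters `a b c` (both sides are the same
integral after `t ↦ 1 − t`; no convergence is needed), the only analytic input being the
principal-branch factorisation `(1 − z + zs)^p = (1 − z)^p (1 − (z/(z−1)) s)^p`, valid because
for `Re z < 1`, `s ∈ [0,1]` both factors lie in the open right half-plane. Contents:

* `re_div_sub_one_lt_one` — the Pfaff variable `z/(z−1)` stays in `H`; it is an involution
  (`div_sub_one_div_sub_one`), `1 − z/(z−1) = (1−z)⁻¹`, and `‖z/(z−1)‖ < 1 ↔ Re z < ½`;
* `one_sub_mul_one_sub_cpow` — the branch-hygiene lemma above;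
* `eulerIntegrand_one_sub`, `eulerIntegral_pfaff`, `eulerHypergeometric_pfaff` — Pfaff for the
  integrand / integral / normalised function, `eulerHypergeometric_pfaff_inv` (the same read from
  `z/(z−1)`), `eulerHypergeometric_neg_ofReal_pfaff` (the throat variable `z = −x`, `x > −1`:
  `E(a,b;c;−x) = (1+x)^{−a} E(a,c−b;c; x/(1+x))`, which sends `x → +∞` to `x/(1+x) → 1⁻`);
* `ordinaryHypergeometric_pfaff` — **Pfaff for Mathlib's series `₂F₁`** on the lens
  `‖z‖ < 1, Re z < ½` (where both `z` and `z/(z−1)` are in the unit disc), for `Re c > Re b > 0`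
  (via DLMF 15.6.1, `eulerHypergeometric_eq_ordinaryHypergeometric`).

Euler's transformation `E(a,b;c;z) = (1−z)^{c−a−b} E(c−a,c−b;c;z)` and Gauss's summation
theorem are in the sibling files `HypergeometricEulerTransformation.lean`,
`HypergeometricGaussSum.lean`.

References: NIST DLMF (15.8.1), (15.6.1) [DLMF]; Andrews–Askey–Roy, *Special Functions* (1999),
Thm 2.2.5 [AndrewsAskeyRoy1999].
-/

noncomputable section

open Filter Metric MeasureTheory Set
open scoped Topology

namespace Literature.Analysis.SpecialFunctions.Hypergeometric

/-! ### The Pfaff variable `z/(z-1)` -/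

/-- `Re(1 − z) > 0` for `Re z < 1`. [folklore] -/
theorem re_one_sub_pos {z : ℂ} (hz : z.re < 1) : 0 < (1 - z).re := by
  rw [Complex.sub_re, Complex.one_re]; linarith

/-- `z ≠ 1` for `Re z < 1`. [folklore] -/
theorem ne_one_of_re_lt_one {z : ℂ} (hz : z.re < 1) : z ≠ 1 := fun h => by
  rw [h, Complex.one_re] at hz; exact lt_irrefl _ hz

/-- **The Pfaff variable stays in the half-plane**: `Re(z/(z−1)) = 1 + Re(z−1)/‖z−1‖² < 1` for
`Re z < 1`. [folklore] -/
theorem re_div_sub_one_lt_one {z : ℂ} (hz : z.re < 1) : (z / (z - 1)).re < 1 := by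
  have hz1 : z - 1 ≠ 0 := sub_ne_zero.2 (ne_one_of_re_lt_one hz)
  have e : z / (z - 1) = 1 + (z - 1)⁻¹ := by field_simp; ring
  have hn : 0 < Complex.normSq (z - 1) := Complex.normSq_pos.2 hz1
  have hre : ((z - 1)⁻¹).re < 0 := by
    rw [Complex.inv_re]
    exact div_neg_of_neg_of_pos (by rw [Complex.sub_re, Complex.one_re]; linarith) hn
  rw [e, Complex.add_re, Complex.one_re]
  linarith

/-- `z ↦ z/(z−1)` is an involution (away from `z = 1`). [folklore] -/
theorem div_sub_one_div_sub_one {z : ℂ} (hz : z ≠ 1) : z / (z - 1) / (z / (z - 1) - 1) = z := by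
  have hz1 : z - 1 ≠ 0 := sub_ne_zero.2 hz
  have h2 : z / (z - 1) - 1 = (z - 1)⁻¹ := by field_simp; ring
  rw [h2]; field_simp

/-- `1 − z/(z−1) = (1 − z)⁻¹` (away from `z = 1`). [folklore] -/
theorem one_sub_div_sub_one {z : ℂ} (hz : z ≠ 1) : 1 - z / (z - 1) = (1 - z)⁻¹ := by
  have hz1 : z - 1 ≠ 0 := sub_ne_zero.2 hz
  have hz1' : 1 - z ≠ 0 := sub_ne_zero.2 (Ne.symm hz)
  field_simp; ring

/-- `z/(z−1)` lies in the open unit disc iff `Re z < ½` (`‖z‖ < ‖z − 1‖`), for `z ≠ 1` (at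
`z = 1` the left side is the junk `‖0‖ < 1`). [folklore] -/
theorem norm_div_sub_one_lt_one_iff {z : ℂ} (hz : z ≠ 1) : ‖z / (z - 1)‖ < 1 ↔ z.re < 1 / 2 := by
  have hz1 : 0 < ‖z - 1‖ := norm_pos_iff.2 (sub_ne_zero.2 hz)
  rw [norm_div, div_lt_one hz1]
  have key : ‖z‖ < ‖z - 1‖ ↔ ‖z‖ ^ 2 < ‖z - 1‖ ^ 2 := (pow_lt_pow_iff_left₀ (norm_nonneg _)
    (norm_nonneg _) two_ne_zero).symm
  rw [key, ← Complex.normSq_eq_norm_sq, ← Complex.normSq_eq_norm_sq, Complex.normSq_apply,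
    Complex.normSq_apply, Complex.sub_re, Complex.sub_im, Complex.one_re, Complex.one_im]
  constructor <;> intro h <;> nlinarith

/-- For `Re z < ½` the Pfaff variable `z/(z−1)` lies in the open unit disc. [folklore] -/
theorem norm_div_sub_one_lt_one {z : ℂ} (hz : z.re < 1 / 2) : ‖z / (z - 1)‖ < 1 :=
  (norm_div_sub_one_lt_one_iff (ne_one_of_re_lt_one (by linarith))).2 hz

/-! ### Principal powers in the right half-plane -/

/-- `(xy)^p = x^p y^p` for `Re x, Re y > 0`: the arguments add up inside `(−π, π]`, so the
principal logarithm is additive. (Inlined; the tree has this under unrelated imports.)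
[folklore] -/
private theorem mul_cpow_of_re_pos_of_re_pos {x y : ℂ} (hx : 0 < x.re) (hy : 0 < y.re) (p : ℂ) :
    (x * y) ^ p = x ^ p * y ^ p := by
  have hx0 : x ≠ 0 := fun h => by rw [h, Complex.zero_re] at hx; exact lt_irrefl _ hx
  have hy0 : y ≠ 0 := fun h => by rw [h, Complex.zero_re] at hy; exact lt_irrefl _ hy
  have harg : x.arg + y.arg ∈ Set.Ioc (-Real.pi) Real.pi := by
    have h1 := abs_lt.1 (Complex.abs_arg_lt_pi_div_two_iff.2 (Or.inl hx))
    have h2 := abs_lt.1 (Complex.abs_arg_lt_pi_div_two_iff.2 (Or.inl hy))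
    constructor <;> linarith [Real.pi_pos]
  rw [Complex.cpow_def_of_ne_zero (mul_ne_zero hx0 hy0), Complex.cpow_def_of_ne_zero hx0,
    Complex.cpow_def_of_ne_zero hy0, Complex.log_mul hx0 hy0 harg, add_mul, Complex.exp_add]

/-- `(x⁻¹)^p = (x^p)⁻¹` for `Re x > 0` (`arg x ≠ π`). [folklore] -/
theorem inv_cpow_of_re_pos {x : ℂ} (hx : 0 < x.re) (p : ℂ) : x⁻¹ ^ p = (x ^ p)⁻¹ := by
  refine Complex.inv_cpow x p fun h => ?_
  have h1 := abs_lt.1 (Complex.abs_arg_lt_pi_div_two_iff.2 (Or.inl hx))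
  rw [h] at h1
  linarith [Real.pi_pos, h1.2]

/-! ### The substitution `t = 1 − s` and the branch factorisation -/

/-- `1 − z(1 − s) = (1 − z)(1 − (z/(z−1)) s)` (away from `z = 1`). [folklore] -/
theorem one_sub_mul_one_sub_eq_mul {z : ℂ} (hz : z ≠ 1) (s : ℂ) :
    1 - z * (1 - s) = (1 - z) * (1 - z / (z - 1) * s) := by
  have hz1 : z - 1 ≠ 0 := sub_ne_zero.2 hz
  field_simp; ring

/-- **Branch hygiene for Pfaff's transformation**: for `Re z < 1`, `s ∈ [0,1]` and any complex
exponent `p`, `(1 − z(1−s))^p = (1 − z)^p · (1 − (z/(z−1)) s)^p` with PRINCIPAL powers — both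
factors `1 − z` and `1 − (z/(z−1))s` have positive real part (`re_div_sub_one_lt_one`,
`re_one_sub_mul_pos`), so no argument wraps. [cite: DLMF, 15.8.1] -/
theorem one_sub_mul_one_sub_cpow {z : ℂ} (hz : z.re < 1) {s : ℝ} (hs0 : 0 ≤ s) (hs1 : s ≤ 1)
    (p : ℂ) :
    (1 - z * (1 - (s : ℂ))) ^ p = (1 - z) ^ p * (1 - z / (z - 1) * (s : ℂ)) ^ p := by
  rw [one_sub_mul_one_sub_eq_mul (ne_one_of_re_lt_one hz)]
  exact mul_cpow_of_re_pos_of_re_pos (re_one_sub_pos hz)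
    (re_one_sub_mul_pos (re_div_sub_one_lt_one hz) hs0 hs1) p

/-- **Euler's integrand under `t = 1 − s`**: for `Re z < 1` and `s ∈ [0,1]`,
`t^{b−1}(1−t)^{c−b−1}(1−zt)^{−a} |_{t = 1−s} = (1−z)^{−a} · s^{(c−b)−1}(1−s)^{c−(c−b)−1}(1 − (z/(z−1))s)^{−a}`,
i.e. `eulerIntegrand a b c z (1 − s) = (1 − z)^{−a} eulerIntegrand a (c−b) c (z/(z−1)) s`.
[cite: DLMF, 15.8.1] -/
theorem eulerIntegrand_one_sub (a b c : ℂ) {z : ℂ} (hz : z.re < 1) {s : ℝ} (hs : s ∈ Icc (0 : ℝ) 1) :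
    eulerIntegrand a b c z (1 - s) = (1 - z) ^ (-a) * eulerIntegrand a (c - b) c (z / (z - 1)) s := by
  simp only [eulerIntegrand, Complex.ofReal_sub, Complex.ofReal_one, sub_sub_cancel]
  rw [one_sub_mul_one_sub_cpow hz hs.1 hs.2 (-a)]
  ring

/-- **Pfaff's transformation for Euler's integral** (no Gamma prefactor, ALL complex
parameters): for `Re z < 1`,
`∫₀¹ t^{b−1}(1−t)^{c−b−1}(1−zt)^{−a} dt = (1−z)^{−a} ∫₀¹ s^{c−b−1}(1−s)^{b−1}(1 − (z/(z−1))s)^{−a} ds`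
(substitute `t = 1 − s`). [cite: DLMF, 15.8.1] -/
theorem eulerIntegral_pfaff (a b c : ℂ) {z : ℂ} (hz : z.re < 1) :
    eulerIntegral a b c z = (1 - z) ^ (-a) * eulerIntegral a (c - b) c (z / (z - 1)) := by
  have h1 : ∫ s in (0 : ℝ)..1, eulerIntegrand a b c z (1 - s) = eulerIntegral a b c z := by
    rw [eulerIntegral, intervalIntegral.integral_comp_sub_left (eulerIntegrand a b c z) 1]
    simp
  rw [← h1, eulerIntegral, ← intervalIntegral.integral_const_mul]
  refine intervalIntegral.integral_congr fun s hs => ?_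
  rw [uIcc_of_le zero_le_one] at hs
  exact eulerIntegrand_one_sub a b c hz hs

/-- **Pfaff's transformation** (DLMF 15.8.1, first form) for Euler's hypergeometric function on
the half-plane `Re z < 1`, ALL complex parameters `a b c`:
`E(a,b;c;z) = (1 − z)^{−a} E(a, c−b; c; z/(z−1))` (principal power; the prefactor
`Γ(c)/(Γ(b)Γ(c−b))` is symmetric under `b ↔ c − b`). [cite: DLMF, 15.8.1] -/
theorem eulerHypergeometric_pfaff (a b c : ℂ) {z : ℂ} (hz : z.re < 1) :
    eulerHypergeometric a b c z =
      (1 - z) ^ (-a) * eulerHypergeometric a (c - b) c (z / (z - 1)) := by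
  rw [eulerHypergeometric, eulerHypergeometric, eulerIntegral_pfaff a b c hz,
    show c - (c - b) = b by ring]
  ring

/-- Pfaff's transformation read from the Pfaff variable: for `Re z < 1`,
`E(a,b;c;z/(z−1)) = (1 − z)^{a} E(a, c−b; c; z)` (`z/(z−1) ↦ z` is the same involution and
`(1 − z/(z−1))^{−a} = ((1−z)⁻¹)^{−a} = (1−z)^{a}` in the right half-plane). [cite: DLMF, 15.8.1] -/
theorem eulerHypergeometric_pfaff_inv (a b c : ℂ) {z : ℂ} (hz : z.re < 1) :
    eulerHypergeometric a b c (z / (z - 1)) = (1 - z) ^ a * eulerHypergeometric a (c - b) c z := by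
  have hz1 := ne_one_of_re_lt_one hz
  rw [eulerHypergeometric_pfaff a b c (re_div_sub_one_lt_one hz), div_sub_one_div_sub_one hz1,
    one_sub_div_sub_one hz1, inv_cpow_of_re_pos (re_one_sub_pos hz), Complex.cpow_neg, inv_inv]

/-- **Pfaff's transformation in the throat variable `z = −x`**: for real `x > −1`,
`E(a,b;c;−x) = (1 + x)^{−a} E(a, c−b; c; x/(1+x))` — the variable `x/(1+x) ∈ [0,1)` tends to
`1⁻` as `x → +∞` (the cap limit of the near-extremal Kerr throat equation). [cite: DLMF, 15.8.1] -/
theorem eulerHypergeometric_neg_ofReal_pfaff (a b c : ℂ) {x : ℝ} (hx : -1 < x) :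
    eulerHypergeometric a b c (-(x : ℂ)) =
      (1 + (x : ℂ)) ^ (-a) * eulerHypergeometric a (c - b) c ((x : ℂ) / (1 + x)) := by
  have hz : (-(x : ℂ)).re < 1 := by simp; linarith
  have hx1 : (1 : ℂ) + x ≠ 0 := by
    intro h
    have := congrArg Complex.re h
    simp at this
    linarith
  rw [eulerHypergeometric_pfaff a b c hz, sub_neg_eq_add,
    show -(x : ℂ) - 1 = -(1 + (x : ℂ)) by ring, neg_div_neg_eq]

/-! ### Pfaff's transformation for Mathlib's series `₂F₁` on the lens `‖z‖ < 1, Re z < ½` -/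

/-- **Pfaff's transformation for Gauss's series** (DLMF 15.8.1) on the lens where both `z` and
`z/(z−1)` lie in the unit disc (`‖z‖ < 1` and `Re z < ½`), for `Re c > Re b > 0`:
`₂F₁(a,b;c;z) = (1 − z)^{−a} ₂F₁(a, c−b; c; z/(z−1))` (Euler's integral on both sides,
DLMF 15.6.1). [cite: DLMF, 15.8.1] -/
theorem ordinaryHypergeometric_pfaff (a : ℂ) {b c : ℂ} (hb : 0 < b.re) (hbc : b.re < c.re)
    {z : ℂ} (hz : ‖z‖ < 1) (hz' : z.re < 1 / 2) :
    ₂F₁ a b c z = (1 - z) ^ (-a) * ₂F₁ a (c - b) c (z / (z - 1)) := by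
  have hre : z.re < 1 := by linarith
  have hcb : 0 < (c - b).re := by rw [Complex.sub_re]; linarith
  have hcbc : (c - b).re < c.re := by rw [Complex.sub_re]; linarith
  rw [← eulerHypergeometric_eq_ordinaryHypergeometric a hb hbc hz,
    ← eulerHypergeometric_eq_ordinaryHypergeometric a hcb hcbc (norm_div_sub_one_lt_one hz'),
    eulerHypergeometric_pfaff a b c hre]

/-- The throat form for the SERIES: for `0 ≤ x < 1` (so that `|−x| < 1` and `x/(1+x) < ½ < 1`),
`₂F₁(a,b;c;−x) = (1 + x)^{−a} ₂F₁(a, c−b; c; x/(1+x))`, `Re c > Re b > 0`. [cite: DLMF, 15.8.1] -/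
theorem ordinaryHypergeometric_neg_ofReal_pfaff (a : ℂ) {b c : ℂ} (hb : 0 < b.re)
    (hbc : b.re < c.re) {x : ℝ} (hx0 : 0 ≤ x) (hx1 : x < 1) :
    ₂F₁ a b c (-(x : ℂ)) = (1 + (x : ℂ)) ^ (-a) * ₂F₁ a (c - b) c ((x : ℂ) / (1 + x)) := by
  have hcb : 0 < (c - b).re := by rw [Complex.sub_re]; linarith
  have hcbc : (c - b).re < c.re := by rw [Complex.sub_re]; linarith
  have hn1 : ‖(-(x : ℂ))‖ < 1 := by
    rw [norm_neg, Complex.norm_real, Real.norm_eq_abs, abs_of_nonneg hx0]; exact hx1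
  have hn2 : ‖(x : ℂ) / (1 + x)‖ < 1 := by
    have h1 : (0 : ℝ) < 1 + x := by linarith
    rw [show (x : ℂ) / (1 + x) = ((x / (1 + x) : ℝ) : ℂ) by push_cast; ring, Complex.norm_real,
      Real.norm_eq_abs, abs_of_nonneg (div_nonneg hx0 h1.le), div_lt_one h1]
    linarith
  rw [← eulerHypergeometric_eq_ordinaryHypergeometric a hb hbc hn1,
    ← eulerHypergeometric_eq_ordinaryHypergeometric a hcb hcbc hn2]
  exact eulerHypergeometric_neg_ofReal_pfaff a b c (by linarith)

end Literature.Analysis.SpecialFunctions.Hypergeometric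

end
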